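import Mathlib
import Literature.Combinatorics.Additive.BorderTricoloredSumFree
import Literature.Combinatorics.Additive.TricoloredSumFreeBound
import Literature.Computability.AlgebraicComplexity.XyzFreeDiagonal
import Literature.Computability.AlgebraicComplexity.XyzFreeDiagonalProofs
import Summits.MatrixMultiplication.MatrixMultiplication.Theorems.SoloInformedCwTwoBorderSumFree
import Summits.MatrixMultiplication.MatrixMultiplication.Theorems.SoloInformedCwTwoBoundedExponent

/-!
# Door D6: every prime-power multiplicity of a near-extremal host is `O(ε N)`

`SoloInformedCwTwoBoundedExponent(Unconditional).lean` closed door D6 (weighted digit designs of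
`S_N`, `SoloInformedCwTwoMonomialDoor.lean`) in hosts of BOUNDED EXPONENT. This file proves the
sharper ISOTYPIC form behind it, unconditionally: for every prime power `q ≥ 2` there is
`θ_q < 1` such that every weighted digit design on `N` coordinates in a host
`B ≅ (ℤ/q)^κ × G'` satisfies

  `3^N ≤ θ_q^κ · |B|`            (`three_pow_le_theta_pow_mul_card_of_design`),

i.e. every copy of `ℤ/q` split off the host costs a factor `θ_q` against the trivial bound
`3^N ≤ |B|`. Consequently a near-extremal host, `|B| ≤ (3+ε)^N`, has

  `κ · log(1/θ_q) ≤ N · log(1 + ε/3)`   (`multiplicity_mul_log_le_of_design`),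

so the multiplicity of EVERY prime power in `B` is `O_q(ε N)`: near-extremal designs can only live
in hosts that are "essentially cyclic" prime by prime. Bounded exponent is the special case where
some multiplicity must be `≥ N log 3 / (ℓ log ℓ)`.

Proof: the blocking argument of `three_pow_le_card_rpow_of_design` (design + Strassen free diagonal
⟹ border tricolored sum-free set in `B^{M'}` ⟹ tricolored sum-free sets in `B^{M'M}`, BCCGNSU
Lemma 3.4), with BCCGNSU Thm. 4.14 in its per-block form
`IsTricoloredSumFree.card_le_of_addEquiv` (saving `θ_q` per `ℤ/q`-coordinate, trivial bound on the
complement `G'`) in place of Thm. A, through the additive equivalence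
`B^{M'M} ≅ (ℤ/q)^{M × M' × κ} × G'^{M'M}` (`funFunAddEquiv`); Strassen's theorem is the tree's
`XyzFreeDiagonalHypothesis_holds`.

References: Blasiak–Church–Cohn–Grochow–Naslund–Sawin–Umans, Discrete Analysis 2017:3, Thm. 4.14,
Lemma 3.4 [BlasiakChurchCohnGrochowNaslundSawinUmans2017]; Strassen 1991 [Strassen1991].
-/

open scoped BigOperators
open Filter Topology

namespace Summit.MatrixMultiplication.MatrixMultiplication.Theorems

open Literature.Combinatorics.Additive Literature.Computability.AlgebraicComplexity

section Equiv

variable {B : Type*} [AddCommGroup B] {κ : Type*} {q : ℕ} {G' : Type*} [AddCommGroup G']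

/-- `B^{M' M} ≅ (ℤ/q)^{M × M' × κ} × G'^{M' M}` coordinatewise, from `B ≅ (ℤ/q)^κ × G'`.
[folklore] -/
def funFunAddEquiv (M M' : ℕ) (e : B ≃+ (κ → ZMod q) × G') :
    (Fin M → Fin M' → B) ≃+ ((Fin M × Fin M' × κ) → ZMod q) × (Fin M → Fin M' → G') :=
  AddEquiv.mk'
    { toFun := fun g => (fun x => (e (g x.1 x.2.1)).1 x.2.2, fun i j => (e (g i j)).2)
      invFun := fun y => fun i j => e.symm (fun l => y.1 (i, j, l), y.2 i j)
      left_inv := by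
        intro g
        funext i j
        simp only [Prod.mk.eta, AddEquiv.symm_apply_apply]
      right_inv := by
        intro y
        simp only [AddEquiv.apply_symm_apply] }
    (by
      intro g h
      ext x
      · simp only [Pi.add_apply, map_add, Prod.fst_add, Equiv.coe_fn_mk, Prod.fst_add,
          Pi.add_apply]
      · simp only [Pi.add_apply, map_add, Prod.snd_add, Equiv.coe_fn_mk])

end Equiv

section Main

/-- **Isotypic form of the door-D6 closure.** For every prime power `q = p^r ≥ 2` there is
`θ ∈ (0,1)` such that for every finite abelian host `B ≅ (ℤ/q)^κ × G'` and every weighted digit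
design (`IsDoorDesign f a`) on `N` coordinates in `B`: `3^N ≤ θ^{|κ|} · |B|`.
[cite: BlasiakChurchCohnGrochowNaslundSawinUmans2017, Thm. 4.14 and Lemma 3.4] -/
theorem three_pow_le_theta_pow_mul_card_of_design {p : ℕ} [Fact p.Prime] {q : ℕ} (r : ℕ)
    (hq : q = p ^ r) (h2q : 2 ≤ q) :
    ∃ θ : ℝ, 0 < θ ∧ θ < 1 ∧ ∀ (N : ℕ) (B : Type) [AddCommGroup B] [Fintype B]
      (κ : Type) [Fintype κ] [DecidableEq κ] (G' : Type) [AddCommGroup G'] [Fintype G']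
      [DecidableEq G'] (_ : B ≃+ (κ → ZMod q) × G')
      (f : Fin N → Fin 3 → B) (a : Fin N → Fin 3 → ℕ), IsDoorDesign f a →
        (3 : ℝ) ^ N ≤ θ ^ Fintype.card κ * Fintype.card B := by
  classical
  haveI : NeZero q := ⟨by omega⟩
  obtain ⟨θ, hθ0, hθ⟩ := exists_theta q
  obtain ⟨hθ1, hLW⟩ := hθ h2q
  refine ⟨θ, hθ0, hθ1, fun N B _ _ κ _ _ G' _ _ _ e f a hdes => ?_⟩
  -- the size of the host
  have hcardB : (Fintype.card B : ℝ) = (q : ℝ) ^ Fintype.card κ * Fintype.card G' := by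
    have := Fintype.card_congr e.toEquiv
    rw [Fintype.card_prod, Fintype.card_fun, ZMod.card] at this
    exact_mod_cast this
  have hq0 : (0 : ℝ) < q := by exact_mod_cast (show 0 < q by omega)
  have hG'1 : (1 : ℝ) ≤ Fintype.card G' := by exact_mod_cast Fintype.card_pos (α := G')
  -- `(θ q)^{|κ|} ≥ 1` (the zero vector is a low-weight vector)
  have hθq1 : (1 : ℝ) ≤ (θ * q) ^ Fintype.card κ := by
    have h1 : 1 ≤ Fintype.card (LowWeight q κ) :=
      Fintype.card_pos_iff.2 ⟨⟨fun _ => ⟨0, by omega⟩, by simp⟩⟩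
    calc (1 : ℝ) ≤ Fintype.card (LowWeight q κ) := by exact_mod_cast h1
      _ ≤ _ := hLW κ
  set Y : ℝ := θ ^ Fintype.card κ * Fintype.card B with hY
  have hYeq : Y = (θ * q) ^ Fintype.card κ * Fintype.card G' := by
    rw [hY, hcardB, mul_pow]; ring
  have hY1 : 1 ≤ Y := by rw [hYeq]; nlinarith
  have hY0 : 0 < Y := by linarith
  rcases Nat.eq_zero_or_pos N with rfl | hN
  · simpa using hY1
  -- N ≥ 1: the main argument, for every η ∈ (0,1)
  refine three_pow_le_of_forall_sub fun η hη hη1 => ?_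
  obtain ⟨k₀, hk₀⟩ := XyzFreeDiagonalHypothesis_holds η hη hη1
  set M' : ℕ := k₀ + 1 with hM'
  have hM'pos : 0 < M' := Nat.succ_pos _
  have hK : k₀ ≤ Fintype.card (Fin M' × Fin N) := by
    rw [Fintype.card_prod, Fintype.card_fin, Fintype.card_fin, hM']
    nlinarith
  obtain ⟨D, hD1, hD2, hDcard⟩ := hk₀ (Fin M' × Fin N) hK
  have hD : IsXyzFreeDiagonal D := ⟨hD1, hD2⟩
  rw [Fintype.card_prod, Fintype.card_fin, Fintype.card_fin] at hDcard
  -- the border tricolored sum-free set and its weight bound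
  have hB := isBorderTricoloredSumFree_of_design (M' := M') hdes hD
  set W₀ : ℕ := ∑ k, (a k 0 + a k 1 + a k 2) with hW₀
  set R : ℕ := 4 * M' * W₀ with hR
  have hRb : ∀ x : D, |3 * (blockWt a x.1.1 : ℤ) - M' * (W₀ : ℕ)| ≤ R ∧
      |3 * (blockWt a x.1.2.1 : ℤ) - M' * (W₀ : ℕ)| ≤ R :=
    fun x => ⟨abs_blockWt_weight_le a _, abs_blockWt_weight_le a _⟩
  -- for every M: Lemma 3.4, then Thm. 4.14 in `(Fin M → Fin M' → B) ≅ (ℤ/q)^{M×M'×κ} × G'^{M M'}`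
  have hineq : ∀ M : ℕ, ((D.card : ℝ)) ^ M ≤ 3 * (2 * M * R + 1) ^ 2 * (Y ^ M') ^ M := by
    intro M
    obtain ⟨Mset, hT, hcnt⟩ := hB.exists_isTricoloredSumFree_pi R hRb M
    have h414 := IsTricoloredSumFree.card_le_of_addEquiv (p := p) r hq
      (funFunAddEquiv M M' e) hT
    have hLW' := hLW (Fin M × Fin M' × κ)
    have hcardκ : Fintype.card (Fin M × Fin M' × κ) = M * (M' * Fintype.card κ) := by
      simp only [Fintype.card_prod, Fintype.card_fin]
    conv at hLW' => rhs; rw [hcardκ]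
    have hcardG : (Fintype.card (Fin M → Fin M' → G') : ℝ) =
        ((Fintype.card G' : ℝ) ^ M') ^ M := by
      rw [Fintype.card_fun, Fintype.card_fun, Fintype.card_fin, Fintype.card_fin]
      push_cast; ring
    have h414' : (Fintype.card Mset : ℝ) ≤
        3 * (Fintype.card (LowWeight q (Fin M × Fin M' × κ)) : ℝ) *
          Fintype.card (Fin M → Fin M' → G') := by exact_mod_cast h414
    have hcnt' : ((D.card : ℝ)) ^ M ≤ (2 * M * R + 1) ^ 2 * (Mset.card : ℝ) := by
      have : (Fintype.card D : ℝ) ^ M ≤ ((2 * M * R + 1) ^ 2 * Mset.card : ℕ) := by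
        exact_mod_cast hcnt
      rw [Fintype.card_coe] at this
      push_cast at this
      exact this
    have hMset : (Mset.card : ℝ) = Fintype.card Mset := by rw [Fintype.card_coe]
    have hYpow : (θ * q) ^ (M * (M' * Fintype.card κ)) * ((Fintype.card G' : ℝ) ^ M') ^ M =
        (Y ^ M') ^ M := by
      rw [hYeq, mul_pow, mul_pow, ← pow_mul, ← pow_mul]
      ring_nf
    calc ((D.card : ℝ)) ^ M ≤ (2 * M * R + 1) ^ 2 * (Mset.card : ℝ) := hcnt'
      _ ≤ (2 * M * R + 1) ^ 2 * (3 * (θ * q) ^ (M * (M' * Fintype.card κ)) *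
            ((Fintype.card G' : ℝ) ^ M') ^ M) := by
          rw [hMset]
          gcongr
          calc (Fintype.card Mset : ℝ)
              ≤ 3 * (Fintype.card (LowWeight q (Fin M × Fin M' × κ)) : ℝ) *
                  Fintype.card (Fin M → Fin M' → G') := h414'
            _ ≤ 3 * (θ * q) ^ (M * (M' * Fintype.card κ)) *
                  Fintype.card (Fin M → Fin M' → G') := by gcongr
            _ = _ := by rw [hcardG]
      _ = 3 * (2 * M * R + 1) ^ 2 * (Y ^ M') ^ M := by rw [← hYpow]; ring
  -- exponential vs polynomial: |D| ≤ Y^{M'}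
  have hDpos : (0 : ℝ) < D.card := lt_of_lt_of_le (by
    have : (0:ℝ) < 3 - η := by linarith
    positivity) hDcard
  have hy : (0 : ℝ) < Y ^ M' := by positivity
  have hle := le_of_pow_le_mul_sq_mul_pow hDpos hy (by norm_num : (0:ℝ) < 3)
    (by positivity : (0:ℝ) ≤ R) hineq
  -- take M'-th roots
  have h3η : (0 : ℝ) ≤ 3 - η := by linarith
  have hpow : ((3 - η) ^ N) ^ M' ≤ Y ^ M' :=
    calc ((3 - η) ^ N) ^ M' = (3 - η) ^ (M' * N) := by rw [← pow_mul, Nat.mul_comm]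
      _ ≤ D.card := hDcard
      _ ≤ _ := hle
  exact (pow_le_pow_iff_left₀ (pow_nonneg h3η N) hY0.le hM'pos.ne').1 hpow

/-- **Near-extremal hosts are essentially cyclic, prime by prime.** With `θ = θ_q` as in
`three_pow_le_theta_pow_mul_card_of_design`: if a weighted digit design on `N` coordinates lives in
`B ≅ (ℤ/q)^κ × G'` with `|B| ≤ (3+ε)^N`, then `|κ| · log(1/θ) ≤ N · log(1 + ε/3)`; in particular
the multiplicity of `ℤ/q` in `B` is at most `N ε / (3 log(1/θ_q)) = O_q(ε N)`.
[cite: BlasiakChurchCohnGrochowNaslundSawinUmans2017, Thm. 4.14] -/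
theorem multiplicity_mul_log_le_of_design {p : ℕ} [Fact p.Prime] {q : ℕ} (r : ℕ)
    (hq : q = p ^ r) (h2q : 2 ≤ q) :
    ∃ θ : ℝ, 0 < θ ∧ θ < 1 ∧ ∀ (N : ℕ) (B : Type) [AddCommGroup B] [Fintype B]
      (κ : Type) [Fintype κ] [DecidableEq κ] (G' : Type) [AddCommGroup G'] [Fintype G']
      [DecidableEq G'] (_ : B ≃+ (κ → ZMod q) × G')
      (f : Fin N → Fin 3 → B) (a : Fin N → Fin 3 → ℕ) (ε : ℝ), 0 ≤ ε → IsDoorDesign f a →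
        (Fintype.card B : ℝ) ≤ (3 + ε) ^ N →
        (Fintype.card κ : ℝ) * Real.log (1 / θ) ≤ N * Real.log (1 + ε / 3) ∧
          (Fintype.card κ : ℝ) ≤ N * ε / (3 * Real.log (1 / θ)) := by
  obtain ⟨θ, hθ0, hθ1, h⟩ := three_pow_le_theta_pow_mul_card_of_design (p := p) r hq h2q
  refine ⟨θ, hθ0, hθ1, fun N B _ _ κ _ _ G' _ _ _ e f a ε hε hdes hB => ?_⟩
  have hmain := h N B κ G' e f a hdes
  have hlog1 : 0 < Real.log (1 / θ) := Real.log_pos (by rw [lt_div_iff₀ hθ0]; linarith)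
  -- 3^N ≤ θ^κ (3+ε)^N  ⟹  (1/θ)^κ ≤ (1+ε/3)^N
  have hkey : (1 / θ) ^ Fintype.card κ ≤ (1 + ε / 3) ^ N := by
    have h3 : (0 : ℝ) < 3 ^ N := by positivity
    have hθκ : 0 < θ ^ Fintype.card κ := by positivity
    have : (3 : ℝ) ^ N ≤ θ ^ Fintype.card κ * (3 + ε) ^ N :=
      hmain.trans (mul_le_mul_of_nonneg_left hB hθκ.le)
    rw [one_div_pow, div_le_iff₀ hθκ, show (1 + ε / 3) ^ N * θ ^ Fintype.card κ =
      θ ^ Fintype.card κ * (3 + ε) ^ N / 3 ^ N by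
        rw [show (1 + ε / 3) = (3 + ε) / 3 by ring, div_pow]; ring]
    rw [le_div_iff₀ h3, one_mul]
    exact this
  have hlogs : (Fintype.card κ : ℝ) * Real.log (1 / θ) ≤ N * Real.log (1 + ε / 3) := by
    have := Real.log_le_log (by positivity) hkey
    rwa [Real.log_pow, Real.log_pow] at this
  refine ⟨hlogs, ?_⟩
  have hlin : Real.log (1 + ε / 3) ≤ ε / 3 := by
    have := Real.add_one_le_exp (ε / 3)
    calc Real.log (1 + ε / 3) ≤ Real.log (Real.exp (ε / 3)) :=
          Real.log_le_log (by positivity) (by linarith)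
      _ = ε / 3 := Real.log_exp _
  rw [le_div_iff₀ (by positivity)]
  calc (Fintype.card κ : ℝ) * (3 * Real.log (1 / θ))
      = 3 * ((Fintype.card κ : ℝ) * Real.log (1 / θ)) := by ring
    _ ≤ 3 * (N * Real.log (1 + ε / 3)) := by gcongr
    _ ≤ 3 * (N * (ε / 3)) := by gcongr
    _ = N * ε := by ring

end Main

end Summit.MatrixMultiplication.MatrixMultiplication.Theorems
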